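import Summits.QuantumFields.YangMills.Theorems.UnitScaleTiltProp7PinnedRegaugeChartDivergence
import Summits.QuantumFields.YangMills.Theorems.UnitScaleTiltProp7CovIterLambdaHLambdaBridge
import HarnessLib

/-!
# Prop 7 pinned re-gauge chart — the ℓ² divergence row of (P-bch) on the torus, through curl, divergence and curvature

Route-R E′, path (α′), gap (P-bch-div) of `stmt-QuantumFields-19200` (crux `MinimiserStabilityRegPr`), cell ym3-torus, width seat px15.

THE STEP.  ✓ `Prop7PinnedRegaugeChartDivergence.sum_norm_divB_chartRemainder_sq_le` bounds `Σ_x‖(D*R₂)(x)‖²` by the three diagonal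
covariant-difference energies `Σ‖D*_μu‖²`, `Σ‖D*_μE_μ‖²`, `Σ‖D*_μδ_μ‖²` with the partners `(τ+ρ)², (σ+ρ)², (σ+τ)²`.  Here, for the torus
`T^{(i)}` with an `SU(N)` background `U₀` whose plaquettes are within `a` of `1` (the door's `W`, read in the units as
`unitsField (toUField U₀)`): (i) `Σ_x‖D*_μG(x)‖² = Σ_x‖D_μG(x)‖²` (re-indexing along the shift; transport by `SU(N)` is an isometry);
(ii) the corrector slot `‖D_μu‖ ≤ 2‖D_μ log u‖` (`exp`-Lipschitz), so its energy is `4·Σ_b‖(D_{U₀} log u)(b)‖²` — the corrector's (I)-row mass;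
(iii) the `E`- and `δ`-slots: diagonal ≤ full covariant gradient energy ≤ `CURL_HS + DIV_HS + 2d·a·N·Σ‖·‖²` by ✓
`Prop7CovIterLambdaHLambdaBridge.sum_normSq_covGrad_le_curl_divB` (the op-norm Weitzenböck inequality, [Balaban1985Variational] (135)), with
`D_ν(Y + 1) = D_νY`.

WHAT IS PROVED (def-free).
* §1 (any shifts `T`, units background `U` with `SU(N)` values `W`): `covDstar_apply_shift` (`D*_μG(x+e_μ) = −R(U_μ(x))⁻¹D_μG(x)`), `norm_R_inv_eq`
  (isometry), ★ `sum_norm_covDstar_sq_eq` (`Σ_x‖D*_μG‖² = Σ_x‖D_μG‖²`), `covD_add_one` (`D_μ(G+1) = D_μG`), ★ `norm_covD_coe_le_two_mul`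
  (`‖D_μu‖ ≤ 2‖D_μ log u‖` for `‖u − 1‖ ≤ σ ≤ 1∕256`).
* §2 (torus `T^{(i)}`, `U₀ : GaugeField P i SU(N)`, `dist1(U₀(∂p)) ≤ a`): `sum_diag_covD_sq_le_curl_divB` (diagonal gradient energy of a bond field
  through ✓ the op-norm Weitzenböck inequality), ★★★ `sum_norm_divB_chartRemainder_sq_le_torus` (THE ℓ² ROW OF (P-bch) ON THE TORUS):
  `Σ_x‖(D*R₂)(x)‖² ≤ 3d·[4(20(τ+ρ))²·Σ_b‖(D_{U₀}log u)(b)‖² + (50(σ+ρ))²·(CURL_HS(Y) + DIV_HS(Y) + 2daN·Σ_b‖Y_b‖²)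
  + (10(σ+τ))²·(CURL_HS(δ) + DIV_HS(δ) + 2daN·Σ_b‖δ_b‖²)]`, `R₂(μ,x) = Φ♯(u(x), Y_{(x,μ)} + 1, δ_{(x,μ)})`, `δ` free bond data of sup `≤ ρ`
  (the knit sets `δ = −D_{U₀} log u`, ✓ `Prop7PinnedRegaugeChartDivergence.neg_covD_mlog_eq`).
HONEST SCOPE.  This is ★p1 g14's 18:21:42Z OUTPUT shape up to his three bookings (`DIV(D_{U₀}log u)` = the corrector's equation, `CURL(D_{U₀}log u) =
[F, ψ]`, `DIV(Y) ≤ C_blk ℓ⁻²M`) and the `Y ↔ D‴ = −i log(Y+1)` re-lettering of the door, which are the knit's.  LHS in operator norm (`≤` HS).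
Constants ours; nothing of the cited papers is asserted.

References: T. Bałaban, CMP 102 (1985) 277–309 [Balaban1985Variational] ((135) p.298, (141)–(143) p.299); CMP 99 (1985) 389–434
[Balaban1985BackgroundPropagators] ((3.3)–(3.10) pp.390–392); CMP 98 (1985) 17–51 [Balaban1985Averaging] ((31) p.22).
-/

set_option autoImplicit false

noncomputable section

open scoped BigOperators Matrix.Norms.L2Operator Matrix
open NormedSpace

namespace Summit.QuantumFields.YangMills.Theorems.Prop7PinnedRegaugeChartDivergenceTorus

open Literature.MathematicalPhysics.QuantumFieldTheory.Balaban1983to89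
open Finset B1RG242Torus
open MatrixLog (mlog exp_mlog norm_mlog_le_two_mul)
open B7Eq78Linearization (conjR)
open B9Eq39Adjoint (R R_def R_add R_sub R_inv_R R_apply_one covD covDstar curl divB)
open B10StarCount (sum_pbond)
open B10Eq27TorusAxialLog (unitsField toUField)
open B9TorusCalculus (torusT)
open Summit.QuantumFields.YangMills.Theorems.Prop7HolRatioPerStep (coe_star_mul_self coe_mul_star_self)
open Summit.QuantumFields.YangMills.Theorems.Prop7CovIterLambdaBound (norm_conj_su_le)
open Summit.QuantumFields.YangMills.Theorems.Prop7GaugeTwistLogRatio (exp_conj_coe)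
open Summit.QuantumFields.YangMills.Theorems.Prop7PinnedRegaugeChartBCH (exp_three_sixteenths_le)
open Summit.QuantumFields.YangMills.Theorems.Prop7CovCombMeanFrames (conjR_bond_su)
open Summit.QuantumFields.YangMills.Theorems.Prop7CovIterLambdaHLambdaBridge (sum_normSq_covGrad_le_curl_divB)
open Summit.QuantumFields.YangMills.Theorems.Prop7PinnedRegaugeChartDivergence (coe_inv_eq_star R_inv_eq_star_mul sum_norm_divB_chartRemainder_sq_le)

/-! ## §1 Re-indexing, isometry, the corrector slot -/

section Abstract

variable {n : Type*} [Fintype n] [DecidableEq n] [Nonempty n]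
variable {S : Type*} {ι : Type*} (T : ι → Equiv.Perm S) (U : ι → S → (Matrix n n ℂ)ˣ)
  (W : ι → S → Matrix.specialUnitaryGroup n ℂ)

omit [Nonempty n] in
/-- `D*_μG(x + e_μ) = −R(U_μ(x))⁻¹(D_μG)(x)`. [folklore] [cite: Balaban1985BackgroundPropagators, (3.8) p.392] -/
theorem covDstar_apply_shift (μ : ι) (G : S → Matrix n n ℂ) (y : S) :
    covDstar T U μ G (T μ y) = -R (U μ y)⁻¹ (covD T U μ G y) := by
  simp only [covDstar, covD, Equiv.symm_apply_apply, R_sub, R_inv_R]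
  abel

/-- Transport by an `SU(N)` value is an isometry: `‖R(U_μ(y))⁻¹Z‖ = ‖Z‖`. [folklore] -/
theorem norm_R_inv_eq (hUW : ∀ μ x, (U μ x : Matrix n n ℂ) = (W μ x : Matrix n n ℂ)) (μ : ι) (y : S) (Z : Matrix n n ℂ) :
    ‖R (U μ y)⁻¹ Z‖ = ‖Z‖ := by
  rw [R_inv_eq_star_mul U W hUW]
  apply le_antisymm
  · have h := norm_conj_su_le (star (W μ y)) Z
    have hc : ((star (W μ y) : Matrix.specialUnitaryGroup n ℂ) : Matrix n n ℂ) = star (W μ y : Matrix n n ℂ) := rfl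
    rw [hc, star_star] at h
    exact h
  · have h := norm_conj_su_le (W μ y) (star (W μ y : Matrix n n ℂ) * Z * (W μ y : Matrix n n ℂ))
    have e : (W μ y : Matrix n n ℂ) * (star (W μ y : Matrix n n ℂ) * Z * (W μ y : Matrix n n ℂ)) * star (W μ y : Matrix n n ℂ)
        = ((W μ y : Matrix n n ℂ) * star (W μ y : Matrix n n ℂ)) * Z * ((W μ y : Matrix n n ℂ) * star (W μ y : Matrix n n ℂ)) := by
      noncomm_ring
    rw [e, coe_mul_star_self, one_mul, mul_one] at h
    exact h

/-- ★ **Re-indexing along the shift**: `Σ_x ‖(D*_μG)(x)‖² = Σ_x ‖(D_μG)(x)‖²` (finite site set, `T_μ` a bijection, `SU(N)` transport).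
[folklore] [cite: Balaban1985BackgroundPropagators, (3.8) p.392] -/
theorem sum_norm_covDstar_sq_eq [Fintype S] (hUW : ∀ μ x, (U μ x : Matrix n n ℂ) = (W μ x : Matrix n n ℂ)) (μ : ι) (G : S → Matrix n n ℂ) :
    ∑ x, ‖covDstar T U μ G x‖ ^ 2 = ∑ x, ‖covD T U μ G x‖ ^ 2 := by
  rw [← Equiv.sum_comp (T μ) (fun x => ‖covDstar T U μ G x‖ ^ 2)]
  refine Finset.sum_congr rfl fun y _ => ?_
  simp only [covDstar_apply_shift, norm_neg, norm_R_inv_eq U W hUW]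

omit [Nonempty n] in
/-- `D_μ(G + 1) = D_μG` (`R(U)1 = 1`). [folklore] [cite: Balaban1985BackgroundPropagators, (3.3) p.390] -/
theorem covD_add_one (μ : ι) (G : S → Matrix n n ℂ) (x : S) :
    covD T U μ (fun z => G z + 1) x = covD T U μ G x := by
  simp only [covD, R_add, R_apply_one]
  abel

/-- ★ **The corrector slot**: for `‖u(x) − 1‖ ≤ σ ≤ 1∕256`, `‖(D_μu)(y)‖ ≤ 2‖(D_μ log u)(y)‖`
(`D_μu = e^{W(log u(y+e_μ))W*} − e^{log u(y)}`, `exp`-Lipschitz ✓ `Literature.Analysis.Complex.norm_exp_sub_exp_le`). [cite: Balaban1985Averaging, (8) p.19] -/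
theorem norm_covD_coe_le_two_mul (hUW : ∀ μ x, (U μ x : Matrix n n ℂ) = (W μ x : Matrix n n ℂ))
    (u : S → Matrix.specialUnitaryGroup n ℂ) {σ : ℝ} (hσ : σ ≤ 1 / 256) (hu : ∀ x, ‖(u x : Matrix n n ℂ) - 1‖ ≤ σ) (μ : ι) (y : S) :
    ‖covD T U μ (fun z => (u z : Matrix n n ℂ)) y‖ ≤ 2 * ‖covD T U μ (fun z => mlog (u z : Matrix n n ℂ)) y‖ := by
  have hu1 : ∀ x, ‖(u x : Matrix n n ℂ) - 1‖ < 1 := fun x => by linarith [hu x]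
  have hlog : ∀ x, ‖mlog (u x : Matrix n n ℂ)‖ ≤ 2 * σ := fun x =>
    (norm_mlog_le_two_mul ((hu x).trans (by linarith))).trans (by linarith [hu x])
  -- the two covariant differences, unfolded
  have e1 : covD T U μ (fun z => (u z : Matrix n n ℂ)) y
      = exp ((W μ y : Matrix n n ℂ) * mlog (u (T μ y) : Matrix n n ℂ) * star (W μ y : Matrix n n ℂ)) - exp (mlog (u y : Matrix n n ℂ)) := by
    rw [exp_conj_coe (W μ y), exp_mlog (hu1 _), exp_mlog (hu1 _)]
    simp only [covD, R_def, coe_inv_eq_star U W hUW, hUW]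
  have e2 : covD T U μ (fun z => mlog (u z : Matrix n n ℂ)) y
      = (W μ y : Matrix n n ℂ) * mlog (u (T μ y) : Matrix n n ℂ) * star (W μ y : Matrix n n ℂ) - mlog (u y : Matrix n n ℂ) := by
    simp only [covD, R_def, coe_inv_eq_star U W hUW, hUW]
  rw [e1, e2]
  have h := Literature.Analysis.Complex.norm_exp_sub_exp_le
    ((W μ y : Matrix n n ℂ) * mlog (u (T μ y) : Matrix n n ℂ) * star (W μ y : Matrix n n ℂ)) (mlog (u y : Matrix n n ℂ))
  have hA : ‖(W μ y : Matrix n n ℂ) * mlog (u (T μ y) : Matrix n n ℂ) * star (W μ y : Matrix n n ℂ)‖ ≤ 3 / 16 :=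
    ((norm_conj_su_le (W μ y) _).trans (hlog _)).trans (by linarith)
  have hB : ‖mlog (u y : Matrix n n ℂ)‖ ≤ 3 / 16 := (hlog y).trans (by linarith)
  have hmax : Real.exp (max ‖(W μ y : Matrix n n ℂ) * mlog (u (T μ y) : Matrix n n ℂ) * star (W μ y : Matrix n n ℂ)‖ ‖mlog (u y : Matrix n n ℂ)‖)
      ≤ 2 := by
    have h1 : Real.exp (max ‖(W μ y : Matrix n n ℂ) * mlog (u (T μ y) : Matrix n n ℂ) * star (W μ y : Matrix n n ℂ)‖ ‖mlog (u y : Matrix n n ℂ)‖)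
        ≤ Real.exp (3 / 16) := Real.exp_le_exp.mpr (max_le hA hB)
    linarith [exp_three_sixteenths_le]
  have h0 : 0 ≤ ‖(W μ y : Matrix n n ℂ) * mlog (u (T μ y) : Matrix n n ℂ) * star (W μ y : Matrix n n ℂ) - mlog (u y : Matrix n n ℂ)‖ :=
    norm_nonneg _
  calc ‖exp ((W μ y : Matrix n n ℂ) * mlog (u (T μ y) : Matrix n n ℂ) * star (W μ y : Matrix n n ℂ)) - exp (mlog (u y : Matrix n n ℂ))‖
      ≤ ‖(W μ y : Matrix n n ℂ) * mlog (u (T μ y) : Matrix n n ℂ) * star (W μ y : Matrix n n ℂ) - mlog (u y : Matrix n n ℂ)‖ * 2 :=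
        h.trans (mul_le_mul_of_nonneg_left hmax h0)
    _ = 2 * ‖(W μ y : Matrix n n ℂ) * mlog (u (T μ y) : Matrix n n ℂ) * star (W μ y : Matrix n n ℂ) - mlog (u y : Matrix n n ℂ)‖ := by ring

end Abstract

/-! ## §2 On the torus: through the op-norm Weitzenböck inequality -/

section Torus

variable {P : Params} {N : ℕ} [NeZero N] {i : ℕ}

omit [NeZero N] in
/-- The units background of the torus calculus has the `SU(N)` values of `U₀`. (bookkeeping) [cite: Balaban1985Averaging, (19) p.21] -/
theorem coe_unitsField_toUField (U₀ : GaugeField P i (Matrix.specialUnitaryGroup (Fin N) ℂ)) (κ : Fin P.d) (z : Site P i) :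
    (((fun κ z => unitsField (toUField U₀) ⟨z, κ⟩) κ z : (Matrix (Fin N) (Fin N) ℂ)ˣ) : Matrix (Fin N) (Fin N) ℂ)
      = (((fun κ z => U₀ ⟨z, κ⟩) κ z : Matrix.specialUnitaryGroup (Fin N) ℂ) : Matrix (Fin N) (Fin N) ℂ) := rfl

/-- **Diagonal covariant gradient energy through curl, divergence and curvature**: for an `SU(N)` background with `dist1(U₀(∂p)) ≤ a` and a
bond field `G`, `Σ_x Σ_μ ‖(D_μG_μ)(x)‖² ≤ CURL_HS(G) + DIV_HS(G) + 2d·a·N·Σ_b‖G_b‖²` (diagonal ≤ full gradient ≤ ✓ the op-norm Weitzenböck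
inequality `Prop7CovIterLambdaHLambdaBridge.sum_normSq_covGrad_le_curl_divB`). [cite: Balaban1985Variational, (135) p.298] -/
theorem sum_diag_covD_sq_le_curl_divB (U₀ : GaugeField P i (Matrix.specialUnitaryGroup (Fin N) ℂ)) {a : ℝ} (ha : 0 ≤ a)
    (hU : ∀ p : Plaq P i, dist1 (GaugeField.plaqHol U₀ p) ≤ a) (G : PBond P i → Matrix (Fin N) (Fin N) ℂ) :
    ∑ x : Site P i, ∑ μ : Fin P.d, ‖covD (torusT P i) (fun κ z => unitsField (toUField U₀) ⟨z, κ⟩) μ (fun z => G ⟨z, μ⟩) x‖ ^ 2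
      ≤ (∑ x : Site P i, ∑ μ : Fin P.d, ∑ ν : Fin P.d,
            (if μ < ν then ∑ j : Fin N, ∑ k : Fin N,
              ‖(curl (torusT P i) (fun κ z => unitsField (toUField U₀) ⟨z, κ⟩) (fun κ z => G ⟨z, κ⟩) μ ν x) j k‖ ^ 2 else 0)
          + ∑ x : Site P i, ∑ j : Fin N, ∑ k : Fin N,
              ‖(divB (torusT P i) (fun κ z => unitsField (toUField U₀) ⟨z, κ⟩) (fun κ z => G ⟨z, κ⟩) x) j k‖ ^ 2)
        + 2 * P.d * a * (N * ∑ b : PBond P i, ‖G b‖ ^ 2) := by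
  have hW := sum_normSq_covGrad_le_curl_divB U₀ ha hU G
  refine le_trans ?_ hW
  rw [sum_pbond]
  refine Finset.sum_le_sum fun x _ => Finset.sum_le_sum fun μ _ => ?_
  have hterm : ∀ ν : Fin P.d,
      ‖((U₀ ⟨x, ν⟩ : Matrix.specialUnitaryGroup (Fin N) ℂ) : Matrix (Fin N) (Fin N) ℂ) * G ⟨x.shift ν, μ⟩
          * star ((U₀ ⟨x, ν⟩ : Matrix.specialUnitaryGroup (Fin N) ℂ) : Matrix (Fin N) (Fin N) ℂ) - G ⟨x, μ⟩‖ ^ 2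
        = ‖covD (torusT P i) (fun κ z => unitsField (toUField U₀) ⟨z, κ⟩) ν (fun z => G ⟨z, μ⟩) x‖ ^ 2 := by
    intro ν
    rw [← conjR_bond_su]
    rfl
  have h := Finset.single_le_sum (s := (Finset.univ : Finset (Fin P.d)))
    (f := fun ν => ‖covD (torusT P i) (fun κ z => unitsField (toUField U₀) ⟨z, κ⟩) ν (fun z => G ⟨z, μ⟩) x‖ ^ 2)
    (fun ν _ => by positivity) (Finset.mem_univ μ)
  refine h.trans (le_of_eq ?_)
  exact Finset.sum_congr rfl fun ν _ => (hterm ν).symm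

/-- ★★★ **THE ℓ² DIVERGENCE ROW OF (P-bch) ON THE TORUS.**  `T^{(i)}`, `SU(N)` background `U₀` with `dist1(U₀(∂p)) ≤ a`, read in the units;
corrector `u : sites → SU(N)`, ratio field `Y`, covariant-difference data `δ` (bond fields), sup rows `‖u(x) − 1‖ ≤ σ`, `‖Y_b‖ ≤ τ`, `‖δ_b‖ ≤ ρ`,
`σ, τ, ρ ≤ 1∕256`; `R₂(μ, x) := Φ♯(u(x), Y_{(x,μ)} + 1, δ_{(x,μ)})` displayed.  Then
`Σ_x‖(D*R₂)(x)‖² ≤ 3d·[4(20(τ+ρ))²·Σ_b‖(D_{U₀}log u)(b)‖² + (50(σ+ρ))²·(CURL_HS(Y) + DIV_HS(Y) + 2daN·Σ_b‖Y_b‖²)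
+ (10(σ+τ))²·(CURL_HS(δ) + DIV_HS(δ) + 2daN·Σ_b‖δ_b‖²)]`.
The corrector's FIRST differences carry `(τ+ρ)² ≍ (s‴+σ₁)²ℓ⁻²`; `σ² ≍ σ₀²` multiplies only the Weitzenböck energies of `Y` and of `δ = −D_{U₀}log u`.
[cite: Balaban1985Variational, (135) p.298, (141)-(143) p.299] [cite: Balaban1985BackgroundPropagators, (3.8) p.392] -/
theorem sum_norm_divB_chartRemainder_sq_le_torus (U₀ : GaugeField P i (Matrix.specialUnitaryGroup (Fin N) ℂ)) {a : ℝ} (ha : 0 ≤ a)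
    (hU : ∀ p : Plaq P i, dist1 (GaugeField.plaqHol U₀ p) ≤ a)
    (u : Site P i → Matrix.specialUnitaryGroup (Fin N) ℂ) (Y δ : PBond P i → Matrix (Fin N) (Fin N) ℂ) {σ τ ρ : ℝ}
    (hσ : σ ≤ 1 / 256) (hτ : τ ≤ 1 / 256) (hρ : ρ ≤ 1 / 256)
    (hu : ∀ x, ‖(u x : Matrix (Fin N) (Fin N) ℂ) - 1‖ ≤ σ) (hY : ∀ b, ‖Y b‖ ≤ τ) (hδ : ∀ b, ‖δ b‖ ≤ ρ) :
    ∑ x : Site P i, ‖divB (torusT P i) (fun κ z => unitsField (toUField U₀) ⟨z, κ⟩)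
        (fun μ y => mlog ((u y : Matrix (Fin N) (Fin N) ℂ) * (Y ⟨y, μ⟩ + 1) * exp (-mlog (u y : Matrix (Fin N) (Fin N) ℂ) + δ ⟨y, μ⟩))
          - (mlog (Y ⟨y, μ⟩ + 1) + δ ⟨y, μ⟩)) x‖ ^ 2
      ≤ 3 * P.d * ((20 * (τ + ρ)) ^ 2 * (4 * ∑ b : PBond P i,
              ‖covD (torusT P i) (fun κ z => unitsField (toUField U₀) ⟨z, κ⟩) b.dir (fun z => mlog (u z : Matrix (Fin N) (Fin N) ℂ)) b.src‖ ^ 2)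
          + (50 * (σ + ρ)) ^ 2 * ((∑ x : Site P i, ∑ μ : Fin P.d, ∑ ν : Fin P.d,
              (if μ < ν then ∑ j : Fin N, ∑ k : Fin N,
                ‖(curl (torusT P i) (fun κ z => unitsField (toUField U₀) ⟨z, κ⟩) (fun κ z => Y ⟨z, κ⟩) μ ν x) j k‖ ^ 2 else 0)
            + ∑ x : Site P i, ∑ j : Fin N, ∑ k : Fin N,
                ‖(divB (torusT P i) (fun κ z => unitsField (toUField U₀) ⟨z, κ⟩) (fun κ z => Y ⟨z, κ⟩) x) j k‖ ^ 2)
            + 2 * P.d * a * (N * ∑ b : PBond P i, ‖Y b‖ ^ 2))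
          + (10 * (σ + τ)) ^ 2 * ((∑ x : Site P i, ∑ μ : Fin P.d, ∑ ν : Fin P.d,
              (if μ < ν then ∑ j : Fin N, ∑ k : Fin N,
                ‖(curl (torusT P i) (fun κ z => unitsField (toUField U₀) ⟨z, κ⟩) (fun κ z => δ ⟨z, κ⟩) μ ν x) j k‖ ^ 2 else 0)
            + ∑ x : Site P i, ∑ j : Fin N, ∑ k : Fin N,
                ‖(divB (torusT P i) (fun κ z => unitsField (toUField U₀) ⟨z, κ⟩) (fun κ z => δ ⟨z, κ⟩) x) j k‖ ^ 2)
            + 2 * P.d * a * (N * ∑ b : PBond P i, ‖δ b‖ ^ 2))) := by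
  have hUW := coe_unitsField_toUField U₀
  -- the abstract ℓ² row
  have h4 := sum_norm_divB_chartRemainder_sq_le (torusT P i) (fun κ z => unitsField (toUField U₀) ⟨z, κ⟩) (fun κ z => U₀ ⟨z, κ⟩) hUW u
    (fun μ y => Y ⟨y, μ⟩ + 1) (fun μ y => δ ⟨y, μ⟩) hσ hτ hρ hu (fun μ x => by rw [add_sub_cancel_right]; exact hY _) (fun μ x => hδ _)
  rw [Fintype.card_fin] at h4
  refine h4.trans ?_
  -- split the right-hand side into the three energies
  simp only [Finset.sum_add_distrib, ← Finset.mul_sum]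
  have hσ0 : 0 ≤ σ := (norm_nonneg _).trans (hu (Classical.arbitrary _))
  -- (u) re-index and `‖D_μu‖ ≤ 2‖D_μ log u‖`
  have Su : ∑ x : Site P i, ∑ μ : Fin P.d, ‖covDstar (torusT P i) (fun κ z => unitsField (toUField U₀) ⟨z, κ⟩) μ
        (fun y => (u y : Matrix (Fin N) (Fin N) ℂ)) x‖ ^ 2
      ≤ 4 * ∑ b : PBond P i, ‖covD (torusT P i) (fun κ z => unitsField (toUField U₀) ⟨z, κ⟩) b.dir
        (fun z => mlog (u z : Matrix (Fin N) (Fin N) ℂ)) b.src‖ ^ 2 := by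
    have hpt : ∀ (μ : Fin P.d) (y : Site P i),
        ‖covD (torusT P i) (fun κ z => unitsField (toUField U₀) ⟨z, κ⟩) μ (fun z => (u z : Matrix (Fin N) (Fin N) ℂ)) y‖ ^ 2
          ≤ 4 * ‖covD (torusT P i) (fun κ z => unitsField (toUField U₀) ⟨z, κ⟩) μ (fun z => mlog (u z : Matrix (Fin N) (Fin N) ℂ)) y‖ ^ 2 := by
      intro μ y
      have h := norm_covD_coe_le_two_mul (torusT P i) _ (fun κ z => U₀ ⟨z, κ⟩) hUW u hσ hu μ y
      have h0 : 0 ≤ ‖covD (torusT P i) (fun κ z => unitsField (toUField U₀) ⟨z, κ⟩) μ (fun z => (u z : Matrix (Fin N) (Fin N) ℂ)) y‖ :=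
        norm_nonneg _
      nlinarith [pow_le_pow_left₀ h0 h 2]
    calc ∑ x : Site P i, ∑ μ : Fin P.d, ‖covDstar (torusT P i) (fun κ z => unitsField (toUField U₀) ⟨z, κ⟩) μ
            (fun y => (u y : Matrix (Fin N) (Fin N) ℂ)) x‖ ^ 2
        = ∑ μ : Fin P.d, ∑ x : Site P i, ‖covDstar (torusT P i) (fun κ z => unitsField (toUField U₀) ⟨z, κ⟩) μ
            (fun y => (u y : Matrix (Fin N) (Fin N) ℂ)) x‖ ^ 2 := Finset.sum_comm
      _ = ∑ μ : Fin P.d, ∑ x : Site P i, ‖covD (torusT P i) (fun κ z => unitsField (toUField U₀) ⟨z, κ⟩) μ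
            (fun y => (u y : Matrix (Fin N) (Fin N) ℂ)) x‖ ^ 2 :=
          Finset.sum_congr rfl fun μ _ => sum_norm_covDstar_sq_eq (torusT P i) _ (fun κ z => U₀ ⟨z, κ⟩) hUW μ _
      _ ≤ ∑ μ : Fin P.d, ∑ x : Site P i, 4 * ‖covD (torusT P i) (fun κ z => unitsField (toUField U₀) ⟨z, κ⟩) μ
            (fun z => mlog (u z : Matrix (Fin N) (Fin N) ℂ)) x‖ ^ 2 :=
          Finset.sum_le_sum fun μ _ => Finset.sum_le_sum fun x _ => hpt μ x
      _ = 4 * ∑ b : PBond P i, ‖covD (torusT P i) (fun κ z => unitsField (toUField U₀) ⟨z, κ⟩) b.dir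
            (fun z => mlog (u z : Matrix (Fin N) (Fin N) ℂ)) b.src‖ ^ 2 := by
          rw [sum_pbond, Finset.mul_sum, Finset.sum_comm]
          exact Finset.sum_congr rfl fun x _ => by rw [Finset.mul_sum]
  -- (E) re-index, `D(Y+1) = DY`, Weitzenböck
  have SE : ∑ x : Site P i, ∑ μ : Fin P.d, ‖covDstar (torusT P i) (fun κ z => unitsField (toUField U₀) ⟨z, κ⟩) μ
        (fun y => Y ⟨y, μ⟩ + 1) x‖ ^ 2
      ≤ (∑ x : Site P i, ∑ μ : Fin P.d, ∑ ν : Fin P.d,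
              (if μ < ν then ∑ j : Fin N, ∑ k : Fin N,
                ‖(curl (torusT P i) (fun κ z => unitsField (toUField U₀) ⟨z, κ⟩) (fun κ z => Y ⟨z, κ⟩) μ ν x) j k‖ ^ 2 else 0)
            + ∑ x : Site P i, ∑ j : Fin N, ∑ k : Fin N,
                ‖(divB (torusT P i) (fun κ z => unitsField (toUField U₀) ⟨z, κ⟩) (fun κ z => Y ⟨z, κ⟩) x) j k‖ ^ 2)
            + 2 * P.d * a * (N * ∑ b : PBond P i, ‖Y b‖ ^ 2) := by
    refine le_trans (le_of_eq ?_) (sum_diag_covD_sq_le_curl_divB U₀ ha hU Y)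
    calc ∑ x : Site P i, ∑ μ : Fin P.d, ‖covDstar (torusT P i) (fun κ z => unitsField (toUField U₀) ⟨z, κ⟩) μ
            (fun y => Y ⟨y, μ⟩ + 1) x‖ ^ 2
        = ∑ μ : Fin P.d, ∑ x : Site P i, ‖covDstar (torusT P i) (fun κ z => unitsField (toUField U₀) ⟨z, κ⟩) μ
            (fun y => Y ⟨y, μ⟩ + 1) x‖ ^ 2 := Finset.sum_comm
      _ = ∑ μ : Fin P.d, ∑ x : Site P i, ‖covD (torusT P i) (fun κ z => unitsField (toUField U₀) ⟨z, κ⟩) μ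
            (fun y => Y ⟨y, μ⟩) x‖ ^ 2 := by
          refine Finset.sum_congr rfl fun μ _ => ?_
          rw [sum_norm_covDstar_sq_eq (torusT P i) _ (fun κ z => U₀ ⟨z, κ⟩) hUW μ]
          exact Finset.sum_congr rfl fun y _ => by rw [covD_add_one (torusT P i) _ μ (fun y => Y ⟨y, μ⟩)]
      _ = ∑ x : Site P i, ∑ μ : Fin P.d, ‖covD (torusT P i) (fun κ z => unitsField (toUField U₀) ⟨z, κ⟩) μ
            (fun y => Y ⟨y, μ⟩) x‖ ^ 2 := Finset.sum_comm
  -- (δ) re-index, Weitzenböck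
  have Sδ : ∑ x : Site P i, ∑ μ : Fin P.d, ‖covDstar (torusT P i) (fun κ z => unitsField (toUField U₀) ⟨z, κ⟩) μ
        (fun y => δ ⟨y, μ⟩) x‖ ^ 2
      ≤ (∑ x : Site P i, ∑ μ : Fin P.d, ∑ ν : Fin P.d,
              (if μ < ν then ∑ j : Fin N, ∑ k : Fin N,
                ‖(curl (torusT P i) (fun κ z => unitsField (toUField U₀) ⟨z, κ⟩) (fun κ z => δ ⟨z, κ⟩) μ ν x) j k‖ ^ 2 else 0)
            + ∑ x : Site P i, ∑ j : Fin N, ∑ k : Fin N,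
                ‖(divB (torusT P i) (fun κ z => unitsField (toUField U₀) ⟨z, κ⟩) (fun κ z => δ ⟨z, κ⟩) x) j k‖ ^ 2)
            + 2 * P.d * a * (N * ∑ b : PBond P i, ‖δ b‖ ^ 2) := by
    refine le_trans (le_of_eq ?_) (sum_diag_covD_sq_le_curl_divB U₀ ha hU δ)
    calc ∑ x : Site P i, ∑ μ : Fin P.d, ‖covDstar (torusT P i) (fun κ z => unitsField (toUField U₀) ⟨z, κ⟩) μ
            (fun y => δ ⟨y, μ⟩) x‖ ^ 2
        = ∑ μ : Fin P.d, ∑ x : Site P i, ‖covDstar (torusT P i) (fun κ z => unitsField (toUField U₀) ⟨z, κ⟩) μ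
            (fun y => δ ⟨y, μ⟩) x‖ ^ 2 := Finset.sum_comm
      _ = ∑ μ : Fin P.d, ∑ x : Site P i, ‖covD (torusT P i) (fun κ z => unitsField (toUField U₀) ⟨z, κ⟩) μ
            (fun y => δ ⟨y, μ⟩) x‖ ^ 2 :=
          Finset.sum_congr rfl fun μ _ => sum_norm_covDstar_sq_eq (torusT P i) _ (fun κ z => U₀ ⟨z, κ⟩) hUW μ _
      _ = ∑ x : Site P i, ∑ μ : Fin P.d, ‖covD (torusT P i) (fun κ z => unitsField (toUField U₀) ⟨z, κ⟩) μ
            (fun y => δ ⟨y, μ⟩) x‖ ^ 2 := Finset.sum_comm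
  have hd : (0 : ℝ) ≤ 3 * P.d := by positivity
  have c1 : (0 : ℝ) ≤ (20 * (τ + ρ)) ^ 2 := sq_nonneg _
  have c2 : (0 : ℝ) ≤ (50 * (σ + ρ)) ^ 2 := sq_nonneg _
  have c3 : (0 : ℝ) ≤ (10 * (σ + τ)) ^ 2 := sq_nonneg _
  have := add_le_add (add_le_add (mul_le_mul_of_nonneg_left Su c1) (mul_le_mul_of_nonneg_left SE c2)) (mul_le_mul_of_nonneg_left Sδ c3)
  exact mul_le_mul_of_nonneg_left this hd

end Torus

end Summit.QuantumFields.YangMills.Theorems.Prop7PinnedRegaugeChartDivergenceTorus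

end
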